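import Mathlib

/-!
# Lex locality — stub `stub_lexLocality` of line `Sketch`, crux stmt-PneNP-2463 (`SolvableImpliesStableSection`)

Deterministic locality of the lexicographically least satisfying assignment of a `k`-CNF.
An instance `Φ : Fin m → Fin k → Fin n × Bool` has `m` clauses over `n` Boolean variables, clause `i`
being satisfied by `σ` iff `∃ j, σ (Φ i j).1 = (Φ i j).2`.  Suppose `Φ'` differs from `Φ` only in
clause `a`, and `Scl ∋ a` is a closed set of clauses: clauses in `Scl` use only variables of `W` (in
both instances) and clauses outside `Scl` use no variable of `W`.  If `x`, `y` are the `toLex`-least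
satisfying assignments of `Φ`, `Φ'`, then `x` and `y` agree outside `W`, hence
`hammingDist x y ≤ #W`.

Proof: the hybrid `z := (x on W, y off W)` satisfies `Φ` and `z' := (y on W, x off W)` satisfies
`Φ'`, so `toLex x ≤ toLex z` and `toLex y ≤ toLex z'` by minimality.  If `x, y` disagreed off `W`,
at the least such variable `i₀` the lemma `Pi.apply_le_of_toLex` would give `x i₀ ≤ z i₀ = y i₀`
and `y i₀ ≤ z' i₀ = x i₀`, a contradiction.  Used by `stub_lowDensityAssembly` (stability of the
lex-least section along the Bresler–Huang resampling path at low clause density).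
-/

set_option linter.dupNamespace false

namespace Summit.PneNP.PneNP.Cruxes.SolvableImpliesStableSection.Sketch

open Finset
open scoped Classical

/-- The hybrid assignment `(x on W, y off W)` satisfies `Φ`, provided `x` satisfies `Φ`, `y`
satisfies `Φ'`, `Φ' = Φ` away from clause `a ∈ Scl`, clauses of `Scl` (in `Φ`) only use variables
of `W` and clauses outside `Scl` use none. -/
private theorem ll_hybrid_sat (k m n : ℕ) (Φ Φ' : Fin m → Fin k → Fin n × Bool) (a : Fin m)
    (Scl : Finset (Fin m)) (W : Finset (Fin n))
    (hagree : ∀ i, i ≠ a → Φ' i = Φ i) (ha : a ∈ Scl)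
    (hin : ∀ i ∈ Scl, ∀ j, (Φ i j).1 ∈ W)
    (hout : ∀ i ∉ Scl, ∀ j, (Φ i j).1 ∉ W)
    (x y : Fin n → Bool)
    (hx : ∀ i, ∃ j, x (Φ i j).1 = (Φ i j).2)
    (hy : ∀ i, ∃ j, y (Φ' i j).1 = (Φ' i j).2) :
    ∀ i, ∃ j, (fun v => if v ∈ W then x v else y v) (Φ i j).1 = (Φ i j).2 := by
  intro i
  by_cases hi : i ∈ Scl
  · obtain ⟨j, hj⟩ := hx i
    refine ⟨j, ?_⟩
    simp only [if_pos (hin i hi j)]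
    exact hj
  · have hia : i ≠ a := fun h => hi (h ▸ ha)
    obtain ⟨j, hj⟩ := hy i
    rw [hagree i hia] at hj
    refine ⟨j, ?_⟩
    simp only [if_neg (hout i hi j)]
    exact hj

/-- Core order argument: if `toLex x ≤ toLex (x on W, y off W)` and
`toLex y ≤ toLex (y on W, x off W)`, then `x` and `y` agree off `W`.  Otherwise, at the least
variable `i₀ ∉ W` with `x i₀ ≠ y i₀`, `Pi.apply_le_of_toLex` gives both `x i₀ ≤ y i₀` and
`y i₀ ≤ x i₀`. -/
private theorem ll_agree_off (n : ℕ) (W : Finset (Fin n)) (x y : Fin n → Bool)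
    (hxz : toLex x ≤ toLex (fun v => if v ∈ W then x v else y v))
    (hyz : toLex y ≤ toLex (fun v => if v ∈ W then y v else x v)) :
    ∀ v, v ∉ W → x v = y v := by
  by_contra hcon
  push Not at hcon
  set D : Finset (Fin n) := univ.filter (fun v => v ∉ W ∧ x v ≠ y v) with hD
  have hDne : D.Nonempty := by
    obtain ⟨v, hv, hne⟩ := hcon
    exact ⟨v, by simp [hD, hv, hne]⟩
  have hi₀D : D.min' hDne ∈ D := D.min'_mem hDne
  have hi₀W : D.min' hDne ∉ W := ((mem_filter.mp hi₀D).2).1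
  have hi₀ne : x (D.min' hDne) ≠ y (D.min' hDne) := ((mem_filter.mp hi₀D).2).2
  -- below the minimum, `x` and `y` agree off `W`
  have hlow : ∀ j < D.min' hDne, j ∉ W → x j = y j := by
    intro j hj hjW
    by_contra hne
    have hjD : j ∈ D := by simp [hD, hjW, hne]
    exact absurd (D.min'_le j hjD) (not_le.mpr hj)
  have hxz' : ∀ j < D.min' hDne, x j = (fun v => if v ∈ W then x v else y v) j := by
    intro j hj
    by_cases hjW : j ∈ W
    · simp [hjW]
    · simp [hjW, hlow j hj hjW]
  have hyz' : ∀ j < D.min' hDne, y j = (fun v => if v ∈ W then y v else x v) j := by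
    intro j hj
    by_cases hjW : j ∈ W
    · simp [hjW]
    · simp [hjW, hlow j hj hjW]
  have h1 : x (D.min' hDne) ≤ y (D.min' hDne) := by
    have := Pi.apply_le_of_toLex hxz hxz'
    simpa [if_neg hi₀W] using this
  have h2 : y (D.min' hDne) ≤ x (D.min' hDne) := by
    have := Pi.apply_le_of_toLex hyz hyz'
    simpa [if_neg hi₀W] using this
  exact hi₀ne (le_antisymm h1 h2)

/-- **Lex locality.**  If `Φ'` differs from `Φ` only in clause `a ∈ Scl`, clauses of `Scl` use only
variables of `W` (in both instances) and clauses outside `Scl` use no variable of `W`, then the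
`toLex`-least satisfying assignments `x` of `Φ` and `y` of `Φ'` satisfy `hammingDist x y ≤ #W`.
Proof: the hybrids `(x on W, y off W)` and `(y on W, x off W)` satisfy `Φ` and `Φ'` respectively
(`ll_hybrid_sat`), so by minimality and `ll_agree_off` the assignments agree off `W`; the set of
disagreements is thus a subset of `W`. -/
theorem stub_lexLocality (k m n : ℕ) (Φ Φ' : Fin m → Fin k → Fin n × Bool) (a : Fin m)
    (Scl : Finset (Fin m)) (W : Finset (Fin n))
    (hagree : ∀ i, i ≠ a → Φ' i = Φ i) (ha : a ∈ Scl)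
    (hin : ∀ i ∈ Scl, ∀ j, (Φ i j).1 ∈ W ∧ (Φ' i j).1 ∈ W)
    (hout : ∀ i ∉ Scl, ∀ j, (Φ i j).1 ∉ W)
    (x y : Fin n → Bool)
    (hx : (∀ i, ∃ j, x (Φ i j).1 = (Φ i j).2) ∧
      ∀ z : Fin n → Bool, (∀ i, ∃ j, z (Φ i j).1 = (Φ i j).2) → toLex x ≤ toLex z)
    (hy : (∀ i, ∃ j, y (Φ' i j).1 = (Φ' i j).2) ∧
      ∀ z : Fin n → Bool, (∀ i, ∃ j, z (Φ' i j).1 = (Φ' i j).2) → toLex y ≤ toLex z) :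
    hammingDist x y ≤ W.card := by
  have hagree' : ∀ i, i ≠ a → Φ i = Φ' i := fun i hi => (hagree i hi).symm
  have hout' : ∀ i ∉ Scl, ∀ j, (Φ' i j).1 ∉ W := by
    intro i hi j
    have hia : i ≠ a := fun h => hi (h ▸ ha)
    rw [hagree i hia]
    exact hout i hi j
  have hz := ll_hybrid_sat k m n Φ Φ' a Scl W hagree ha (fun i hi j => (hin i hi j).1) hout x y
    hx.1 hy.1
  have hz' := ll_hybrid_sat k m n Φ' Φ a Scl W hagree' ha (fun i hi j => (hin i hi j).2) hout' y x
    hy.1 hx.1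
  have hxz := hx.2 (fun v => if v ∈ W then x v else y v) hz
  have hyz := hy.2 (fun v => if v ∈ W then y v else x v) hz'
  have hagr := ll_agree_off n W x y hxz hyz
  unfold hammingDist
  refine card_le_card (fun v hv => ?_)
  rw [mem_filter] at hv
  by_contra hvW
  exact hv.2 (hagr v hvW)

end Summit.PneNP.PneNP.Cruxes.SolvableImpliesStableSection.Sketch
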